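import Literature.AlgebraicGeometry.Frobenioids.Prop55Sub
import Literature.AlgebraicGeometry.Frobenioids.PerfectionIsotropic
import Literature.AlgebraicGeometry.Frobenioids.PerfectionEndomorphisms
import Literature.AlgebraicGeometry.Frobenioids.PerfectionFrobeniusArrows
import Literature.AlgebraicGeometry.Frobenioids.PerfectionDivisorial
import Literature.AlgebraicGeometry.Frobenioids.IsoSubanchorNotIsotropic
import Literature.AlgebraicGeometry.Frobenioids.DivIdentityPrimeRays
import HarnessLib

/-!
# Frobenioids I, Proposition 5.5 (iii): "if `C` is of standard type, then so is `C^pf`" — the clauses of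
# Definition 3.1 (i) for THE perfection

Mochizuki, *The geometry of Frobenioids I: the general theory*, Kyushu J. Math. **62** (2008)
293–400, Prop. 5.5 (iii), first sentence, kurims text p. 104 ll. 36–37, proof p. 105 ll. 11–20: "assertion
(iii) for `C^pf` follows immediately from the definitions [cf. also Proposition 3.2, (ii), (iii)] by observing
that `C^pf` is of isotropic type, and that by assertion (i) … `O^▷(−)` of the image of `A` in `(C^*)^pf` is
the perfection of `O^▷(A)`" [cite: MochizukiFrdI2008, Prop. 5.5 (iii) p.104].

PROOF-ONLY file (cell abc-iut, sub-DAG `plan/L1/SUBDAG-FrdI-Thm51iv-Prop55.md`, row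
`FrdI:Prop5.5(iii)/P55-L06 PfPreservesStandardTypes`, seat abc-iut-w5-d042; no new notions) over THE
perfection `C^pf = PreFrobenioid.Perfection hF` with operations `Perfection.ops hF` (seat abc-iut-L1-d9) and
the statements file `Prop55Sub.lean` (seat abc-iut-w4-d084).  The clauses of Def. 3.1 (i) (p. 56) for the
operations `S := Perfection.ops hF`, transferred one by one from `C`:

* (a) quasi-isotropic: every object of `C^pf` is isotropic (Prop. 3.2 (iii), `isOfIsotropicType_perfection`)
  and — GIVEN that `C^pf → F_{Φ^pf}` is a Frobenioid (Prop. 3.2 (iii), hypothesis `hPf`, the cone node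
  `FrdI:Prop3.2(iii)` deferred BY NAME) — no object of `C^pf` is an iso-subanchor (Remark 3.1.1);
  Frobenius-isotropic: identities are of Frobenius type (`isOfQuasiIsotropicType_ops`,
  `isOfFrobeniusIsotropicType_ops`);
* (b) "if of group-like type then a Frobenius-compact isotropic object": `C^pf` is of group-like type iff `C`
  is (`isOfGroupLikeType_ops_iff`: `Φ(A)^pf = 0 ⟺ Φ(A) = 0`, `Φ(A)` being sharp); the Frobenius-compact
  object itself is NOT produced here — print's route is Prop. 5.5 (i) (`O^▷((A,1)) = O^▷(A)^pf`, rows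
  P55-L01/L02) together with a control of `Aut_{C^pf}((A,1))` that the tree does not hold; the closing theorem
  below carries this conjunct as the hypothesis `hb` (disclosed; no `def … : Prop` is introduced);
* (c) Frobenius-normalized type (`isOfFrobeniusNormalizedType_ops`): an equation `α^d ∘ φ = φ ∘ α` between a
  base-identity endomorphism `φ` of `(A, n)` and `α ∈ O^▷((A, n))` is checked on representatives at a common
  diagonal level `A^{(c)}` (`PerfectionEndomorphisms`: `endClassHom`, `isBaseIdentity_endClass_iff`,
  `endClassHom_mem_iff`), where it is Frobenius normalization of `C` at `A^{(c)}`;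
* (d) `D` of FSMFF-type: the base category is the same;
* (e) `Φ^pf` non-dilating (`isNonDilatingOn_ops`): for a sharp monoid `M` and a non-dilating `α : M → M`,
  `α^pf : M^pf → M^pf` is non-dilating (`Perfection.isNonDilating_map`) — primary elements and `≼` are detected
  through `M → M^pf` and `M → M^char` (§0 p. 12: `Perfection.isPrimary_of_iff`, `Perfection.of_precsim_of_iff`,
  `isPrimary_associatesMk_iff` of `DivIdentityPrimeRays`), so the
  hypothesis of Def. 1.1 (i) for `α^pf` restricts to that for `α`, forcing `α = id`, `α^pf = id`.

Closing theorem: `FrdI.Prop55Sub.prop55iii_pf_standard_of` — the slot `FrdI.Prop55Sub.Prop55iii_pf_standard F hF`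
GIVEN `hPf` (Prop. 3.2 (iii) by name, as in the sibling slots `_pf_ratStd`, `_pf_model`) and GIVEN clause (b)
for `C^pf` as the hypothesis `hb` (CONDITIONAL; said so).  No statement of the paper is restated or
strengthened; HONEST FRAMING: [FrdI] is a refereed paper; nothing here bears on [IUTchIII] Cor. 3.12 beyond
supplying kernel-checked inputs by name.
-/

namespace Literature.AlgebraicGeometry.Frobenioids

open CategoryTheory Opposite

universe w v v' u u'

/-! ### Definition 1.1 (i) under perfection: `α` non-dilating ⇒ `α^pf` non-dilating (sharp `M`) -/

section Monoid

variable {M : Type u} [CommMonoid M]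

/-- Def. 1.1 (i) read back on `M` for a SHARP monoid (`M = M^char`): a non-dilating `α` with `α(a) ≼ a` for
all primary `a ∈ M` is the identity. [cite: MochizukiFrdI2008, Def. 1.1 (i) p.19] -/
theorem IsNonDilating.eq_id_of_isSharp (hM : IsSharp M) {α : M →* M} (hα : IsNonDilating α)
    (h : ∀ a : M, IsPrimary a → α a ≼ a) : α = MonoidHom.id M := by
  have hchar : associatesMap α = MonoidHom.id _ := hα fun x hx => by
    obtain ⟨a, rfl⟩ := Associates.mk_surjective x
    rw [associatesMap_mk]
    exact precsim_associatesMk_iff.mpr (h a ((isPrimary_associatesMk_iff hM).mp hx))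
  ext a
  have e : Associates.mk (α a) = Associates.mk a := by
    rw [← associatesMap_mk, hchar, MonoidHom.id_apply]
  obtain ⟨u, hu⟩ := Associates.mk_eq_mk_iff_associated.mp e
  have hu1 : (u : M) = 1 := hM.1 (u : M) u.isUnit
  calc α a = α a * u := by rw [hu1, mul_one]
    _ = a := hu

/-- **`α` non-dilating ⇒ `α^pf` non-dilating** for a sharp monoid `M` (Def. 1.1 (i) with §0 p. 12: primary
elements and `≼` of `M^pf` are detected through `M → M^pf`, and `M^pf` is again sharp; the hypothesis of
Def. 1.1 (i) for `α^pf` thus restricts to the one for `α`, which forces `α = id`, whence `α^pf = id`).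
[cite: MochizukiFrdI2008, Def. 1.1 (i) p.19] -/
theorem Perfection.isNonDilating_map (hM : IsSharp M) {α : M →* M} (hα : IsNonDilating α) :
    IsNonDilating (Perfection.map α) := by
  intro H
  have hid : α = MonoidHom.id M := hα.eq_id_of_isSharp hM fun a ha => by
    have h1 := H (Associates.mk (Perfection.of M a))
      ((isPrimary_associatesMk_iff (Perfection.isSharp hM)).mpr ((Perfection.isPrimary_of_iff hM).mpr ha))
    rw [associatesMap_mk] at h1
    exact Perfection.of_precsim_of_iff.mp (precsim_associatesMk_iff.mp h1)
  rw [hid, Perfection.map_id]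
  ext x
  obtain ⟨y, rfl⟩ := Associates.mk_surjective x
  rw [associatesMap_mk, MonoidHom.id_apply, MonoidHom.id_apply]

/-- The two renderings of Def. 1.1 (i) in the tree — abc-iut-L1-t3's pointwise `PreFrobenioidData.IsNonDilating`
and found's `IsNonDilating` (`α^char = id` as homomorphisms) — agree. [cite: MochizukiFrdI2008, Def. 1.1 (i) p.19] -/
theorem PreFrobenioidData.isNonDilating_iff_isNonDilating (α : M →* M) :
    PreFrobenioidData.IsNonDilating α ↔ _root_.Literature.AlgebraicGeometry.Frobenioids.IsNonDilating α := by
  unfold PreFrobenioidData.IsNonDilating _root_.Literature.AlgebraicGeometry.Frobenioids.IsNonDilating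
  refine imp_congr_right fun _ => ?_
  rw [MonoidHom.ext_iff]
  rfl

end Monoid

namespace PreFrobenioid

variable {D : Type u} [Category.{v} D] {Φ : Dᵒᵖ ⥤ CommMonCat.{w}}
  {C : Type u'} [Category.{v'} C] {F : C ⥤ ElemFrobenioid Φ}

namespace Perfection

variable {hF : IsFrobenioid F}

/-! ### (a) isotropic, no iso-subanchors, Frobenius-isotropic -/

/-- The identity of an object of `C^pf` is of Frobenius type (the class of the identity of `A^{(1)}`, an
isomorphism of `C`). [cite: MochizukiFrdI2008, Prop. 3.2 (ii) p.59] -/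
theorem isFrobeniusType_id_ops (X : Perfection hF) : (ops hF).IsFrobeniusType (𝟙 X) := by
  have h : IsFrobeniusType F (Rep.id X).hom :=
    isFrobeniusType_of_isIso F hF.isPreFrobenioid (𝟙 (frobPow hF X.obj 1))
  rw [id_eq_mk]
  exact isFrobeniusType_mk_of (Rep.id X) h

/-- `C^pf` is of Frobenius-isotropic type, for `C` of Frobenius-isotropic type (every object is isotropic,
Prop. 3.2 (iii), and identities are of Frobenius type). [cite: MochizukiFrdI2008, Prop. 3.2 (iii) p.59] -/
theorem isOfFrobeniusIsotropicType_ops (hF : IsFrobenioid F) (hiso : IsOfType (IsFrobeniusIsotropic F)) :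
    (ops hF).IsOfFrobeniusIsotropicType :=
  ⟨fun X => ⟨X, 𝟙 X, isFrobeniusType_id_ops X, (isOfIsotropicType_perfection hF hiso).obj X⟩⟩

/-- Isotropic type of `C^pf` in found's functor-level vocabulary, for the structure functor
`(Perfection.ops hF).toFunctor : C^pf → F_{Φ^pf}` (its operations ARE `Perfection.ops hF`).
[cite: MochizukiFrdI2008, Prop. 3.2 (iii) p.59] -/
theorem isOfIsotropicType_toFunctor (hF : IsFrobenioid F) (hiso : IsOfType (IsFrobeniusIsotropic F)) :
    IsOfIsotropicType (ops hF).toFunctor := fun X =>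
  (PreFrobenioidData.ofFunctor_isIsotropic (ops hF).toFunctor X).mp ((isOfIsotropicType_perfection hF hiso).obj X)

/-- No object of `C^pf` is an iso-subanchor — Remark 3.1.1 for the Frobenioid `C^pf → F_{Φ^pf}` (GIVEN that it
is one, Prop. 3.2 (iii), hypothesis `hPf`), which is of isotropic type. [cite: MochizukiFrdI2008, Rem. 3.1.1 p.57] -/
theorem not_isIsoSubanchor_ops (hF : IsFrobenioid F) (hPf : IsFrobenioid (ops hF).toFunctor)
    (hiso : IsOfType (IsFrobeniusIsotropic F)) (X : Perfection hF) : ¬ IsIsoSubanchor X :=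
  not_isIsoSubanchor_of_isOfIsotropicType hPf (isOfIsotropicType_toFunctor hF hiso) X

/-- **Def. 3.1 (i)(a) for `C^pf`**: `C^pf` is of quasi-isotropic type (both sides of "non-isotropic ⟺
iso-subanchor" are empty), GIVEN Prop. 3.2 (iii) by name. [cite: MochizukiFrdI2008, Prop. 5.5 (iii) p.104] -/
theorem isOfQuasiIsotropicType_ops (hF : IsFrobenioid F) (hPf : IsFrobenioid (ops hF).toFunctor)
    (hiso : IsOfType (IsFrobeniusIsotropic F)) : (ops hF).IsOfQuasiIsotropicType :=
  ⟨fun X => ⟨fun h => (h ((isOfIsotropicType_perfection hF hiso).obj X)).elim,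
    fun h => (not_isIsoSubanchor_ops hF hPf hiso X h).elim⟩⟩

/-! ### (b) group-like type is detected on `C` -/

/-- `(A, n)` is group-like in `C^pf` iff `A` is group-like in `C`: `Φ(Base A)^pf = 0 ⟺ Φ(Base A) = 0`, the
divisor monoid `Φ(Base A)` being sharp. [cite: MochizukiFrdI2008, Def. 1.2 (iv) p.23] -/
theorem isGroupLikeObj_ops_iff (X : Perfection hF) : (ops hF).IsGroupLikeObj X ↔ IsGroupLikeObj F X.obj := by
  have hsh : IsSharp (Φ.obj (op (baseObj F X.obj))) := (hF.isPreFrobenioid.isDivisorial _).isSharp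
  change (∀ y : Frobenioids.Perfection (Φ.obj (op (baseObj F X.obj))), y = 1) ↔
    ∀ x : Φ.obj (op (baseObj F X.obj)), x = 1
  constructor
  · intro h x
    exact (Frobenioids.Perfection.mk_eq_one_iff_of_isSharp hsh (n := 1)).mp (h (Frobenioids.Perfection.of _ x))
  · intro h y
    obtain ⟨⟨a, n⟩, rfl⟩ := Frobenioids.Perfection.mk_surjective y
    change Frobenioids.Perfection.mk a n = 1
    rw [h a, Frobenioids.Perfection.mk_one]

/-- **`C^pf` is of group-like type iff `C` is.** [cite: MochizukiFrdI2008, Def. 1.2 (v) p.23] -/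
theorem isOfGroupLikeType_ops_iff (hF : IsFrobenioid F) :
    (ops hF).IsOfGroupLikeType ↔ (PreFrobenioidData.ofFunctor Φ F).IsOfGroupLikeType :=
  ⟨fun h => ⟨fun A => (isGroupLikeObj_ops_iff (hF := hF) (root hF A 1)).mp (h.obj _)⟩,
    fun h => ⟨fun X => (isGroupLikeObj_ops_iff X).mpr (h.obj X.obj)⟩⟩

/-! ### (c) Frobenius-normalized type -/

/-- **`(A, n)` is Frobenius-normalized in `C^pf`** when `C` is of Frobenius-normalized type: for a base-identity
endomorphism `φ = [θ]` and `α = [a] ∈ O^▷((A, n))`, with `θ`, `a` endomorphisms of a common `A^{(c)}` (`θ`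
base-identity, `a ∈ O^▷(A^{(c)})`, `deg_Fr(φ) = deg_Fr(θ)`), the relation `a^d ∘ θ = θ ∘ a` of Def. 1.2 (iv)
at `A^{(c)}` maps to `α^d ∘ φ = φ ∘ α` under the homomorphism `End_C(A^{(c)}) → End_{C^pf}((A, n))`.
[cite: MochizukiFrdI2008, Prop. 5.5 (iii) p.104] -/
theorem isFrobeniusNormalized_ops (hnorm : (PreFrobenioidData.ofFunctor Φ F).IsOfFrobeniusNormalizedType)
    (X : Perfection hF) : (ops hF).IsFrobeniusNormalized X := by
  intro φ hφ α hα
  obtain ⟨c, θ, rfl⟩ := exists_endClassHom_eq X φ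
  obtain ⟨c', a, ha, rfl⟩ := exists_endClassHom_eq_of_mem X hα
  -- transport both representatives to the common diagonal level `c · c'`
  have h₁ : c ∣ c * c' := dvd_mul_right c c'
  have h₂ : c' ∣ c * c' := dvd_mul_left c' c
  rw [← endClassHom_liftLevel X h₁ θ rfl, ← endClassHom_liftLevel X h₂ a rfl] at *
  set θ' : End (frobPow hF X.obj (c * c')) := End.of (liftLevel hF (End.asHom θ) h₁ h₁ rfl) with hθ'
  set a' : End (frobPow hF X.obj (c * c')) := End.of (liftLevel hF (End.asHom a) h₂ h₂ rfl) with ha'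
  have hθ'b : IsBaseIdentity F (End.asHom θ') := (isBaseIdentity_endClass_iff X (c * c') (End.asHom θ')).mp hφ
  have ha'm : a' ∈ endSubmonoid F (frobPow hF X.obj (c * c')) := (endClassHom_mem_iff X (c * c') a').mp hα
  have key := hnorm.obj (frobPow hF X.obj (c * c')) θ' hθ'b a' ha'm
  have e := congrArg (endClassHom X (c * c')) key
  rw [map_mul, map_mul, map_pow] at e
  exact e

/-- **Def. 3.1 (i)(c) for `C^pf`**: `C^pf` is of Frobenius-normalized type if `C` is.
[cite: MochizukiFrdI2008, Prop. 5.5 (iii) p.104] -/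
theorem isOfFrobeniusNormalizedType_ops (hF : IsFrobenioid F)
    (hnorm : (PreFrobenioidData.ofFunctor Φ F).IsOfFrobeniusNormalizedType) :
    (ops hF).IsOfFrobeniusNormalizedType :=
  ⟨fun X => isFrobeniusNormalized_ops (hF := hF) hnorm X⟩

/-- The same from found's functor-level "`C` is of Frobenius-normalized type" (the printed standing hypothesis
of Prop. 5.5). [cite: MochizukiFrdI2008, Prop. 5.5 (iii) p.104] -/
theorem isOfFrobeniusNormalizedType_ops' (hF : IsFrobenioid F) (hnorm : IsOfType (IsFrobeniusNormalized F)) :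
    (ops hF).IsOfFrobeniusNormalizedType :=
  isOfFrobeniusNormalizedType_ops hF ⟨fun A φ hφ α hα => hnorm A φ hφ α hα⟩

/-! ### (e) `Φ^pf` is non-dilating -/

/-- **Def. 3.1 (i)(e) for `C^pf`**: the divisor monoid `Φ^pf` of `C^pf` is non-dilating if `Φ` is (each
`Φ(A)` is sharp, `Perfection.isNonDilating_map`). [cite: MochizukiFrdI2008, Prop. 5.5 (iii) p.104] -/
theorem isNonDilatingOn_ops (hF : IsFrobenioid F) (hnd : (PreFrobenioidData.ofFunctor Φ F).IsNonDilatingOn) :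
    (ops hF).IsNonDilatingOn :=
  ⟨fun X f => (PreFrobenioidData.isNonDilating_iff_isNonDilating _).mpr
    (Frobenioids.Perfection.isNonDilating_map (hF.isPreFrobenioid.isDivisorial X).isSharp
      ((PreFrobenioidData.isNonDilating_iff_isNonDilating _).mp (hnd.nonDilating X f)))⟩

end Perfection

end PreFrobenioid

/-! ### Proposition 5.5 (iii), first sentence, "standard": the slot of `Prop55Sub.lean` -/

namespace FrdI.Prop55Sub

open PreFrobenioid

variable {D : Type u} [Category.{v} D] {Φ : Dᵒᵖ ⥤ CommMonCat.{w}}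
  {C : Type u'} [Category.{v'} C] {F : C ⥤ ElemFrobenioid Φ}

/-- **Proposition 5.5 (iii), "if `C` is of standard type, then so is `C^pf`"** — the slot
`Prop55iii_pf_standard F hF`, GIVEN (1) that `C^pf → F_{Φ^pf}` is a Frobenioid (Prop. 3.2 (iii), hypothesis
`hPf`, cone node `FrdI:Prop3.2(iii)` deferred by name — used only for "no iso-subanchors", Rem. 3.1.1) and
(2) clause (b) of Def. 3.1 (i) for `C^pf` (hypothesis `hb`: if `C^pf` is of group-like type then it has a
Frobenius-compact isotropic object — print derives it from Prop. 5.5 (i); not produced in this file).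
Clauses (a), (c), (d), (e) are proved: `isOfQuasiIsotropicType_ops`, `isOfFrobeniusIsotropicType_ops`,
`isOfFrobeniusNormalizedType_ops`, `IsOfStandardType.fsmff`, `isNonDilatingOn_ops`.  CONDITIONAL on (1)(2).
[cite: MochizukiFrdI2008, Prop. 5.5 (iii) p.104] -/
theorem prop55iii_pf_standard_of (hF : IsFrobenioid F) (hPf : IsFrobenioid (Perfection.ops hF).toFunctor)
    (hb : (Perfection.ops hF).IsOfGroupLikeType →
      ∃ X, (Perfection.ops hF).IsIsotropic X ∧ (Perfection.ops hF).IsFrobeniusCompact X) :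
    Prop55iii_pf_standard F hF := fun hiso _ hS =>
  { quasiIsotropic := Perfection.isOfQuasiIsotropicType_ops hF hPf hiso
    frobeniusIsotropic := Perfection.isOfFrobeniusIsotropicType_ops hF hiso
    frobeniusCompact_of_groupLike := hb
    frobeniusNormalized := Perfection.isOfFrobeniusNormalizedType_ops hF hS.frobeniusNormalized
    fsmff := hS.fsmff
    nonDilating := Perfection.isNonDilatingOn_ops hF hS.nonDilating }

/-- The same closing, with clause (b) discharged VACUOUSLY when `C` is not of group-like type (then neither is
`C^pf`, `isOfGroupLikeType_ops_iff`): for `C` NOT of group-like type, `Prop55iii_pf_standard F hF` holds GIVEN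
Prop. 3.2 (iii) by name only. [cite: MochizukiFrdI2008, Prop. 5.5 (iii) p.104] -/
theorem prop55iii_pf_standard_of_not_groupLike (hF : IsFrobenioid F)
    (hPf : IsFrobenioid (Perfection.ops hF).toFunctor) (hng : ¬ IsOfType (IsGroupLikeObj F)) :
    Prop55iii_pf_standard F hF :=
  prop55iii_pf_standard_of hF hPf fun hGL =>
    (hng fun A => (PreFrobenioidData.ofFunctor_isGroupLikeObj F A).mp
      (((Perfection.isOfGroupLikeType_ops_iff hF).mp hGL).obj A)).elim

end FrdI.Prop55Sub

end Literature.AlgebraicGeometry.Frobenioids
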